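import Summits.CriticalPhenomena.PercolationContinuityZ3.Theorems.PercNearOneGluingNoHeavyLowerTailKnQuestion8CoefficientwiseCoreClassKernelMixPathTransfer
import HarnessLib

/-!
# IET on a two-arc edge set: the assembly of the two fibre lemmas (THEOREM IET-CYCLE modulo the arc combinatorics)

Support file (`--supports stmt-CriticalPhenomena-4575`, closed), prover `prim-cplus-coupling` (gen 39).  No definitions, no notations, no named facts,
no sorries; standard axioms.  Memo `prim-cplus-coupling/A5-COUPLING-gen39.md` §3.

THEOREM IET-CYCLE (memo §3): for a cycle `E = W₁ ⊔ W₂` through `u, b` (two edge-disjoint `u–b` arcs) and EVERY up-closed event `𝒱`,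
`Σ_{ω ∈ 𝒱 : b ∈ X∖Y} h(X)k(X) + Σ_{ω ∈ 𝒱 : b ∈ Y∖X} (hᵃX − hᵇY)(kᵃX − kᵇY) ≥ 0` (`X = C_u ω`, `Y = C_u(E∖ω)`).  Its proof has three layers:
(1) the two abstract fibre lemmas (`…KernelMixFibreInjection`, `…KernelMixFibreUpset`), (2) their instantiation on an arc (cluster combinatorics of a
path: the partial swap `σ` of `…KernelMixSigmaFlip` plus the run structure — NOT in this file), and (3) the ASSEMBLY: split the demand by the blue arc
(`D₁`: `W₁` blue; `D₂`: `W₂` blue, `W₁` mixed), the supply by the red arc, and serve each side by the right fibre inequality according to which sides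
carry demand — when both do, `𝒱` contains every colouring with a red arc, so each side may use its FULL partner set.  This file is layer (3):
* `Coefficientwise.iet_twoArc_assembly` — for disjoint nonempty `W₁, W₂` with `b ∈ C_u ω ↔ (W₁ ⊆ ω ∨ W₂ ⊆ ω)` on `ω ⊆ W₁ ∪ W₂` (the only `u–b` routes
  are the two arcs), the four fibre inequalities (FIBRE INJECTION and FIBRE UP-SET for each arc, stated for the clusters of this edge set) imply IET for
  every up-closed `𝒱` and the given levels.
[cite: KozmaNitzan2024, Questions 8–9 (§5.5 p. 36) (context: the Question-8 pocket covariance programme)]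
-/

namespace Summit.CriticalPhenomena.PercolationContinuityZ3.Theorems

open Finset Literature.Probability.Percolation

namespace Coefficientwise

variable {ι V : Type*}

open Classical in
/-- **Assembly of THEOREM IET-CYCLE from the fibre inequalities.**  `W₁, W₂` disjoint nonempty edge sets, `E = W₁ ∪ W₂`, such that for every
`ω ⊆ E`: `b ∈ C_u(ω) ↔ W₁ ⊆ ω ∨ W₂ ⊆ ω`.  Write `T(η) = (hᵃ(C_u η) − hᵇ(C_u(E∖η)))(kᵃ(C_u η) − kᵇ(C_u(E∖η)))`.  Assume, for the arc `W₂` as the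
free arc (partners `ζ ∪ W₁`): (FI₁) for every family `F` of subsets of `W₂` with `∅ ∉ F`, `0 ≤ Σ_{F∖{W₂}} T + Σ_{ζ ⊆ W₂, ζ ∉ {∅,W₂}} hk(C_u(ζ ∪ W₁))`;
(FU₁) for every up-closed `F ∋ W₂`, `0 ≤ Σ_{F∖{W₂}} T + Σ_{ζ ∈ F∖{∅}} hk(C_u(ζ ∪ W₁))`; and (FI₂), (FU₂) symmetrically.  Then for every up-closed `𝒱`:
`0 ≤ Σ_{ω ⊆ E : 𝒱 ω, b ∈ C_u ω, b ∉ C_u(E∖ω)} h(C_u ω)k(C_u ω) + Σ_{ω ⊆ E : 𝒱 ω, b ∈ C_u(E∖ω), b ∉ C_u ω} T(ω)`.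
[cite: KozmaNitzan2024, Questions 8–9 (§5.5 p. 36) (context)] -/
theorem iet_twoArc_assembly [DecidableEq ι] (ends : ι → Sym2 V) (W₁ W₂ : Finset ι) (hW : Disjoint W₁ W₂)
    (hW₁ : W₁.Nonempty) (hW₂ : W₂.Nonempty) (u b : V)
    (hroute : ∀ ω : Finset ι, ω ⊆ W₁ ∪ W₂ → (b ∈ openCluster (ends '' (↑ω : Set ι)) u ↔ (W₁ ⊆ ω ∨ W₂ ⊆ ω)))
    (𝒱 : Finset ι → Prop) (hV : ∀ ⦃s t : Finset ι⦄, s ⊆ t → 𝒱 s → 𝒱 t)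
    (h k ha hb ka kb : Set V → ℝ) (hh0 : ∀ S, 0 ≤ h S) (hk0 : ∀ S, 0 ≤ k S)
    (hFI₁ : ∀ F : Finset (Finset ι), (∀ η ∈ F, η ⊆ W₂) → ∅ ∉ F →
      0 ≤ (∑ η ∈ F.erase W₂, (ha (openCluster (ends '' (↑η : Set ι)) u) - hb (openCluster (ends '' (↑((W₁ ∪ W₂) \ η) : Set ι)) u)) *
            (ka (openCluster (ends '' (↑η : Set ι)) u) - kb (openCluster (ends '' (↑((W₁ ∪ W₂) \ η) : Set ι)) u)))
        + ∑ ζ ∈ (W₂.powerset.erase ∅).erase W₂, h (openCluster (ends '' (↑(ζ ∪ W₁) : Set ι)) u) * k (openCluster (ends '' (↑(ζ ∪ W₁) : Set ι)) u))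
    (hFU₁ : ∀ F : Finset (Finset ι), (∀ η ∈ F, η ⊆ W₂) → (∀ η ∈ F, ∀ ζ : Finset ι, η ⊆ ζ → ζ ⊆ W₂ → ζ ∈ F) → W₂ ∈ F →
      0 ≤ (∑ η ∈ F.erase W₂, (ha (openCluster (ends '' (↑η : Set ι)) u) - hb (openCluster (ends '' (↑((W₁ ∪ W₂) \ η) : Set ι)) u)) *
            (ka (openCluster (ends '' (↑η : Set ι)) u) - kb (openCluster (ends '' (↑((W₁ ∪ W₂) \ η) : Set ι)) u)))
        + ∑ ζ ∈ F.erase ∅, h (openCluster (ends '' (↑(ζ ∪ W₁) : Set ι)) u) * k (openCluster (ends '' (↑(ζ ∪ W₁) : Set ι)) u))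
    (hFI₂ : ∀ F : Finset (Finset ι), (∀ η ∈ F, η ⊆ W₁) → ∅ ∉ F →
      0 ≤ (∑ η ∈ F.erase W₁, (ha (openCluster (ends '' (↑η : Set ι)) u) - hb (openCluster (ends '' (↑((W₁ ∪ W₂) \ η) : Set ι)) u)) *
            (ka (openCluster (ends '' (↑η : Set ι)) u) - kb (openCluster (ends '' (↑((W₁ ∪ W₂) \ η) : Set ι)) u)))
        + ∑ ζ ∈ (W₁.powerset.erase ∅).erase W₁, h (openCluster (ends '' (↑(ζ ∪ W₂) : Set ι)) u) * k (openCluster (ends '' (↑(ζ ∪ W₂) : Set ι)) u))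
    (hFU₂ : ∀ F : Finset (Finset ι), (∀ η ∈ F, η ⊆ W₁) → (∀ η ∈ F, ∀ ζ : Finset ι, η ⊆ ζ → ζ ⊆ W₁ → ζ ∈ F) → W₁ ∈ F →
      0 ≤ (∑ η ∈ F.erase W₁, (ha (openCluster (ends '' (↑η : Set ι)) u) - hb (openCluster (ends '' (↑((W₁ ∪ W₂) \ η) : Set ι)) u)) *
            (ka (openCluster (ends '' (↑η : Set ι)) u) - kb (openCluster (ends '' (↑((W₁ ∪ W₂) \ η) : Set ι)) u)))
        + ∑ ζ ∈ F.erase ∅, h (openCluster (ends '' (↑(ζ ∪ W₂) : Set ι)) u) * k (openCluster (ends '' (↑(ζ ∪ W₂) : Set ι)) u)) :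
    0 ≤ (∑ ω ∈ (W₁ ∪ W₂).powerset, if 𝒱 ω ∧ b ∈ openCluster (ends '' (↑ω : Set ι)) u ∧ b ∉ openCluster (ends '' (↑((W₁ ∪ W₂) \ ω) : Set ι)) u then
        h (openCluster (ends '' (↑ω : Set ι)) u) * k (openCluster (ends '' (↑ω : Set ι)) u) else 0)
      + ∑ ω ∈ (W₁ ∪ W₂).powerset, if 𝒱 ω ∧ b ∈ openCluster (ends '' (↑((W₁ ∪ W₂) \ ω) : Set ι)) u ∧ b ∉ openCluster (ends '' (↑ω : Set ι)) u then
        (ha (openCluster (ends '' (↑ω : Set ι)) u) - hb (openCluster (ends '' (↑((W₁ ∪ W₂) \ ω) : Set ι)) u)) *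
          (ka (openCluster (ends '' (↑ω : Set ι)) u) - kb (openCluster (ends '' (↑((W₁ ∪ W₂) \ ω) : Set ι)) u)) else 0 := by
  set E : Finset ι := W₁ ∪ W₂ with hE
  set C : Finset ι → Set V := fun ω => openCluster (ends '' (↑ω : Set ι)) u with hC
  set Tf : Finset ι → ℝ := fun η => (ha (C η) - hb (C (E \ η))) * (ka (C η) - kb (C (E \ η))) with hTf
  set HK : Finset ι → ℝ := fun ω => h (C ω) * k (C ω) with hHK
  change 0 ≤ (∑ ω ∈ E.powerset, if 𝒱 ω ∧ b ∈ C ω ∧ b ∉ C (E \ ω) then HK ω else 0)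
      + ∑ ω ∈ E.powerset, if 𝒱 ω ∧ b ∈ C (E \ ω) ∧ b ∉ C ω then Tf ω else 0
  have hHK0 : ∀ ω, 0 ≤ HK ω := fun ω => mul_nonneg (hh0 _) (hk0 _)
  have hW₁E : W₁ ⊆ E := Finset.subset_union_left
  have hW₂E : W₂ ⊆ E := Finset.subset_union_right
  -- red / blue reachability of b in terms of the arcs
  have hred : ∀ ω, ω ⊆ E → (b ∈ C ω ↔ (W₁ ⊆ ω ∨ W₂ ⊆ ω)) := fun ω hω => hroute ω hω
  have hblue : ∀ ω, ω ⊆ E → (b ∈ C (E \ ω) ↔ (Disjoint W₁ ω ∨ Disjoint W₂ ω)) := by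
    intro ω hω
    rw [hred (E \ ω) Finset.sdiff_subset]
    have e1 : W₁ ⊆ E \ ω ↔ Disjoint W₁ ω :=
      ⟨fun h' => Finset.disjoint_left.mpr fun x hx hxω => (Finset.mem_sdiff.mp (h' hx)).2 hxω,
       fun h' x hx => Finset.mem_sdiff.mpr ⟨hW₁E hx, fun hxω => Finset.disjoint_left.mp h' hx hxω⟩⟩
    have e2 : W₂ ⊆ E \ ω ↔ Disjoint W₂ ω :=
      ⟨fun h' => Finset.disjoint_left.mpr fun x hx hxω => (Finset.mem_sdiff.mp (h' hx)).2 hxω,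
       fun h' x hx => Finset.mem_sdiff.mpr ⟨hW₂E hx, fun hxω => Finset.disjoint_left.mp h' hx hxω⟩⟩
    rw [e1, e2]
  -- elementary facts about subsets of the two arcs
  have hsubW₂_of_disj : ∀ ω, ω ⊆ E → Disjoint W₁ ω → ω ⊆ W₂ := by
    intro ω hω hd x hx
    rcases Finset.mem_union.mp (hω hx) with h1 | h2
    · exact absurd hx (Finset.disjoint_left.mp hd h1)
    · exact h2
  have hsubW₁_of_disj : ∀ ω, ω ⊆ E → Disjoint W₂ ω → ω ⊆ W₁ := by
    intro ω hω hd x hx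
    rcases Finset.mem_union.mp (hω hx) with h1 | h2
    · exact h1
    · exact absurd hx (Finset.disjoint_left.mp hd h2)
  have hnotW₁_sub : ∀ ω, ω ⊆ W₂ → ¬ W₁ ⊆ ω := by
    intro ω hω h1
    obtain ⟨x, hx⟩ := hW₁
    exact Finset.disjoint_left.mp hW hx (hω (h1 hx))
  have hnotW₂_sub : ∀ ω, ω ⊆ W₁ → ¬ W₂ ⊆ ω := by
    intro ω hω h2
    obtain ⟨x, hx⟩ := hW₂
    exact Finset.disjoint_left.mp hW (hω (h2 hx)) hx
  -- the demand set splits along the blue arc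
  set D1 : Finset (Finset ι) := (W₂.powerset.filter (fun η => 𝒱 η)).erase W₂ with hD1
  set D2 : Finset (Finset ι) := ((W₁.powerset.filter (fun η => 𝒱 η)).erase ∅).erase W₁ with hD2
  have hmemD1 : ∀ η, η ∈ D1 ↔ η ⊆ W₂ ∧ 𝒱 η ∧ η ≠ W₂ := by
    intro η; simp only [hD1, Finset.mem_erase, Finset.mem_filter, Finset.mem_powerset]; tauto
  have hmemD2 : ∀ η, η ∈ D2 ↔ η ⊆ W₁ ∧ 𝒱 η ∧ η ≠ ∅ ∧ η ≠ W₁ := by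
    intro η; simp only [hD2, Finset.mem_erase, Finset.mem_filter, Finset.mem_powerset]; tauto
  have hdem_split : ∑ ω ∈ E.powerset, (if 𝒱 ω ∧ b ∈ C (E \ ω) ∧ b ∉ C ω then Tf ω else 0)
      = (∑ η ∈ D1, Tf η) + ∑ η ∈ D2, Tf η := by
    rw [← Finset.sum_filter]
    have hset : E.powerset.filter (fun ω => 𝒱 ω ∧ b ∈ C (E \ ω) ∧ b ∉ C ω) = D1 ∪ D2 := by
      ext ω
      simp only [Finset.mem_filter, Finset.mem_powerset, Finset.mem_union, hmemD1, hmemD2]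
      constructor
      · rintro ⟨hωE, hv, hbl, hrd⟩
        rw [hblue ω hωE] at hbl; rw [hred ω hωE] at hrd
        by_cases hd1 : Disjoint W₁ ω
        · left
          have hω2 := hsubW₂_of_disj ω hωE hd1
          exact ⟨hω2, hv, fun hEq => hrd (Or.inr (hEq ▸ le_refl ω))⟩
        · right
          have hd2 : Disjoint W₂ ω := hbl.resolve_left hd1
          have hω1 := hsubW₁_of_disj ω hωE hd2
          refine ⟨hω1, hv, ?_, fun hEq => hrd (Or.inl (hEq ▸ le_refl ω))⟩
          intro h0
          exact hd1 (h0 ▸ Finset.disjoint_empty_right W₁)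
      · rintro (⟨hω2, hv, hne⟩ | ⟨hω1, hv, hne0, hne⟩)
        · have hωE : ω ⊆ E := le_trans hω2 hW₂E
          refine ⟨hωE, hv, (hblue ω hωE).mpr (Or.inl (Finset.disjoint_of_subset_right hω2 hW)), ?_⟩
          rw [hred ω hωE]
          rintro (h1 | h2)
          · exact hnotW₁_sub ω hω2 h1
          · exact hne (Finset.Subset.antisymm hω2 h2)
        · have hωE : ω ⊆ E := le_trans hω1 hW₁E
          refine ⟨hωE, hv, (hblue ω hωE).mpr (Or.inr (Finset.disjoint_of_subset_right hω1 hW.symm)), ?_⟩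
          rw [hred ω hωE]
          rintro (h1 | h2)
          · exact hne (Finset.Subset.antisymm hω1 h1)
          · exact hnotW₂_sub ω hω1 h2
    have hdisj : Disjoint D1 D2 := by
      rw [Finset.disjoint_left]
      intro ω h1 h2
      obtain ⟨hω2, _, _⟩ := (hmemD1 ω).mp h1
      obtain ⟨hω1, _, hne0, _⟩ := (hmemD2 ω).mp h2
      apply hne0
      exact Finset.eq_empty_of_forall_notMem fun x hx => Finset.disjoint_left.mp hW (hω1 hx) (hω2 hx)
    rw [hset, Finset.sum_union hdisj]
  -- the supply dominates any admissible system of partners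
  have hsup_bound : ∀ Z₁ Z₂ : Finset (Finset ι), (∀ ζ ∈ Z₁, ζ ⊆ W₂ ∧ ζ ≠ ∅ ∧ 𝒱 (ζ ∪ W₁)) → (∀ ζ ∈ Z₂, ζ ⊆ W₁ ∧ ζ ≠ ∅ ∧ 𝒱 (ζ ∪ W₂)) →
      W₁ ∉ Z₂ →
      (∑ ζ ∈ Z₁, HK (ζ ∪ W₁)) + ∑ ζ ∈ Z₂, HK (ζ ∪ W₂)
        ≤ ∑ ω ∈ E.powerset, (if 𝒱 ω ∧ b ∈ C ω ∧ b ∉ C (E \ ω) then HK ω else 0) := by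
    intro Z₁ Z₂ hZ₁ hZ₂ hW₁Z₂
    have inj1 : Set.InjOn (fun ζ : Finset ι => ζ ∪ W₁) ↑Z₁ := by
      intro ζ hζ ζ' hζ' heq
      have h1 := (hZ₁ ζ hζ).1; have h2 := (hZ₁ ζ' hζ').1
      have e1 : (ζ ∪ W₁) ∩ W₂ = ζ := by
        rw [Finset.union_inter_distrib_right, Finset.inter_eq_left.mpr h1, Finset.disjoint_iff_inter_eq_empty.mp hW, Finset.union_empty]
      have e2 : (ζ' ∪ W₁) ∩ W₂ = ζ' := by
        rw [Finset.union_inter_distrib_right, Finset.inter_eq_left.mpr h2, Finset.disjoint_iff_inter_eq_empty.mp hW, Finset.union_empty]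
      have : (ζ ∪ W₁) ∩ W₂ = (ζ' ∪ W₁) ∩ W₂ := by simp only at heq; rw [heq]
      rwa [e1, e2] at this
    have inj2 : Set.InjOn (fun ζ : Finset ι => ζ ∪ W₂) ↑Z₂ := by
      intro ζ hζ ζ' hζ' heq
      have h1 := (hZ₂ ζ hζ).1; have h2 := (hZ₂ ζ' hζ').1
      have e1 : (ζ ∪ W₂) ∩ W₁ = ζ := by
        rw [Finset.union_inter_distrib_right, Finset.inter_eq_left.mpr h1, Finset.disjoint_iff_inter_eq_empty.mp hW.symm, Finset.union_empty]
      have e2 : (ζ' ∪ W₂) ∩ W₁ = ζ' := by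
        rw [Finset.union_inter_distrib_right, Finset.inter_eq_left.mpr h2, Finset.disjoint_iff_inter_eq_empty.mp hW.symm, Finset.union_empty]
      have : (ζ ∪ W₂) ∩ W₁ = (ζ' ∪ W₂) ∩ W₁ := by simp only at heq; rw [heq]
      rwa [e1, e2] at this
    set P1 : Finset (Finset ι) := Z₁.image (fun ζ => ζ ∪ W₁) with hP1
    set P2 : Finset (Finset ι) := Z₂.image (fun ζ => ζ ∪ W₂) with hP2
    have s1 : ∑ ζ ∈ Z₁, HK (ζ ∪ W₁) = ∑ ω ∈ P1, HK ω := (Finset.sum_image (f := HK) inj1).symm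
    have s2 : ∑ ζ ∈ Z₂, HK (ζ ∪ W₂) = ∑ ω ∈ P2, HK ω := (Finset.sum_image (f := HK) inj2).symm
    have hdisjP : Disjoint P1 P2 := by
      rw [Finset.disjoint_left]
      intro ω h1 h2
      obtain ⟨ζ, hζ, rfl⟩ := Finset.mem_image.mp h1
      obtain ⟨ζ', hζ', heq⟩ := Finset.mem_image.mp h2
      -- W₁ ⊆ ζ' ∪ W₂ with ζ' ⊆ W₁ forces ζ' = W₁
      have hζ'1 := (hZ₂ ζ' hζ').1
      have : W₁ ⊆ ζ' := by
        intro x hx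
        have hx' : x ∈ ζ' ∪ W₂ := by rw [heq]; exact Finset.mem_union_right _ hx
        rcases Finset.mem_union.mp hx' with h' | h'
        · exact h'
        · exact absurd h' (Finset.disjoint_left.mp hW hx)
      exact hW₁Z₂ ((Finset.Subset.antisymm hζ'1 this) ▸ hζ')
    have hsupp : ∀ ω ∈ P1 ∪ P2, ω ∈ E.powerset ∧ (𝒱 ω ∧ b ∈ C ω ∧ b ∉ C (E \ ω)) := by
      intro ω hω
      rcases Finset.mem_union.mp hω with h1 | h2
      · obtain ⟨ζ, hζ, rfl⟩ := Finset.mem_image.mp h1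
        obtain ⟨hζ2, hζ0, hvζ⟩ := hZ₁ ζ hζ
        have hωE : ζ ∪ W₁ ⊆ E := Finset.union_subset (le_trans hζ2 hW₂E) hW₁E
        refine ⟨Finset.mem_powerset.mpr hωE, hvζ, (hred _ hωE).mpr (Or.inl Finset.subset_union_right), ?_⟩
        rw [hblue _ hωE]
        rintro (hd | hd)
        · obtain ⟨x, hx⟩ := hW₁
          exact Finset.disjoint_left.mp hd hx (Finset.mem_union_right _ hx)
        · obtain ⟨x, hx⟩ := Finset.nonempty_iff_ne_empty.mpr hζ0
          exact Finset.disjoint_left.mp hd (hζ2 hx) (Finset.mem_union_left _ hx)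
      · obtain ⟨ζ, hζ, rfl⟩ := Finset.mem_image.mp h2
        obtain ⟨hζ1, hζ0, hvζ⟩ := hZ₂ ζ hζ
        have hωE : ζ ∪ W₂ ⊆ E := Finset.union_subset (le_trans hζ1 hW₁E) hW₂E
        refine ⟨Finset.mem_powerset.mpr hωE, hvζ, (hred _ hωE).mpr (Or.inr Finset.subset_union_right), ?_⟩
        rw [hblue _ hωE]
        rintro (hd | hd)
        · obtain ⟨x, hx⟩ := Finset.nonempty_iff_ne_empty.mpr hζ0
          exact Finset.disjoint_left.mp hd (hζ1 hx) (Finset.mem_union_left _ hx)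
        · obtain ⟨x, hx⟩ := hW₂
          exact Finset.disjoint_left.mp hd hx (Finset.mem_union_right _ hx)
    have hPE : P1 ∪ P2 ⊆ E.powerset := fun ω hω => (hsupp ω hω).1
    calc (∑ ζ ∈ Z₁, HK (ζ ∪ W₁)) + ∑ ζ ∈ Z₂, HK (ζ ∪ W₂) = ∑ ω ∈ P1 ∪ P2, HK ω := by
          rw [s1, s2, Finset.sum_union hdisjP]
      _ = ∑ ω ∈ P1 ∪ P2, (if 𝒱 ω ∧ b ∈ C ω ∧ b ∉ C (E \ ω) then HK ω else 0) :=
          Finset.sum_congr rfl fun ω hω => by rw [if_pos (hsupp ω hω).2]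
      _ ≤ ∑ ω ∈ E.powerset, (if 𝒱 ω ∧ b ∈ C ω ∧ b ∉ C (E \ ω) then HK ω else 0) :=
          Finset.sum_le_sum_of_subset_of_nonneg hPE fun ω _ _ => by split_ifs <;> [exact hHK0 ω; exact le_refl 0]
  rw [hdem_split]
  set Ssup := ∑ ω ∈ E.powerset, (if 𝒱 ω ∧ b ∈ C ω ∧ b ∉ C (E \ ω) then HK ω else 0) with hSsup
  have hSsup0 : 0 ≤ Ssup := Finset.sum_nonneg fun ω _ => by split_ifs <;> [exact hHK0 ω; exact le_refl 0]
  -- the up-sets of the two fibres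
  set F1 : Finset (Finset ι) := W₂.powerset.filter (fun η => 𝒱 η) with hF1
  set F2 : Finset (Finset ι) := W₁.powerset.filter (fun η => 𝒱 η) with hF2
  have hF1sub : ∀ η ∈ F1, η ⊆ W₂ := fun η hη => Finset.mem_powerset.mp (Finset.mem_filter.mp hη).1
  have hF2sub : ∀ η ∈ F2, η ⊆ W₁ := fun η hη => Finset.mem_powerset.mp (Finset.mem_filter.mp hη).1
  have hF1up : ∀ η ∈ F1, ∀ ζ : Finset ι, η ⊆ ζ → ζ ⊆ W₂ → ζ ∈ F1 :=
    fun η hη ζ hηζ hζ => Finset.mem_filter.mpr ⟨Finset.mem_powerset.mpr hζ, hV hηζ (Finset.mem_filter.mp hη).2⟩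
  have hF2up : ∀ η ∈ F2, ∀ ζ : Finset ι, η ⊆ ζ → ζ ⊆ W₁ → ζ ∈ F2 :=
    fun η hη ζ hηζ hζ => Finset.mem_filter.mpr ⟨Finset.mem_powerset.mpr hζ, hV hηζ (Finset.mem_filter.mp hη).2⟩
  have hD1F1 : D1 = F1.erase W₂ := rfl
  by_cases hD2ne : ∃ η : Finset ι, η ⊆ W₁ ∧ 𝒱 η ∧ η ≠ ∅ ∧ η ≠ W₁
  · obtain ⟨η₁, hη₁W, hη₁V, hη₁0, hη₁ne⟩ := hD2ne
    have hVW₁ : ∀ ζ : Finset ι, 𝒱 (ζ ∪ W₁) := fun ζ => hV (le_trans hη₁W Finset.subset_union_right) hη₁V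
    have hW₁F2 : W₁ ∈ F2 := hF2up η₁ (Finset.mem_filter.mpr ⟨Finset.mem_powerset.mpr hη₁W, hη₁V⟩) W₁ hη₁W (le_refl W₁)
    by_cases hD1ne : ∃ η : Finset ι, η ⊆ W₂ ∧ 𝒱 η ∧ η ≠ W₂
    · -- (iii) both sides carry demand: full partner sets are in 𝒱
      obtain ⟨η₂, hη₂W, hη₂V, hη₂ne⟩ := hD1ne
      have hVW₂ : ∀ ζ : Finset ι, 𝒱 (ζ ∪ W₂) := fun ζ => hV (le_trans hη₂W Finset.subset_union_right) hη₂V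
      -- side 2 by the fibre injection lemma on the family F2 ∖ {∅}
      have side2 := hFI₂ (F2.erase ∅) (fun η hη => hF2sub η (Finset.mem_of_mem_erase hη)) (Finset.notMem_erase ∅ F2)
      have eD2 : (F2.erase ∅).erase W₁ = D2 := rfl
      rw [eD2] at side2
      have bound2 : ∀ ζ ∈ (W₁.powerset.erase ∅).erase W₁, ζ ⊆ W₁ ∧ ζ ≠ ∅ ∧ 𝒱 (ζ ∪ W₂) := by
        intro ζ hζ
        simp only [Finset.mem_erase, Finset.mem_powerset] at hζ
        exact ⟨hζ.2.2, hζ.2.1, hVW₂ ζ⟩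
      have hW₁notin : W₁ ∉ (W₁.powerset.erase ∅).erase W₁ := Finset.notMem_erase W₁ _
      by_cases hV0 : 𝒱 ∅
      · -- 𝒱 is everything: side 1 by the fibre up-set lemma on the full cube (all-red included)
        have hF1all : F1 = W₂.powerset := by
          ext η; simp only [hF1, Finset.mem_filter, Finset.mem_powerset]
          exact ⟨fun h' => h'.1, fun h' => ⟨h', hV (Finset.empty_subset η) hV0⟩⟩
        have side1 := hFU₁ W₂.powerset (fun η hη => Finset.mem_powerset.mp hη)
          (fun η _ ζ _ hζ => Finset.mem_powerset.mpr hζ) (Finset.mem_powerset.mpr (le_refl W₂))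
        have eD1 : W₂.powerset.erase W₂ = D1 := by rw [hD1F1, hF1all]
        rw [eD1] at side1
        have bound1 : ∀ ζ ∈ W₂.powerset.erase ∅, ζ ⊆ W₂ ∧ ζ ≠ ∅ ∧ 𝒱 (ζ ∪ W₁) := by
          intro ζ hζ
          simp only [Finset.mem_erase, Finset.mem_powerset] at hζ
          exact ⟨hζ.2, hζ.1, hVW₁ ζ⟩
        have sb := hsup_bound (W₂.powerset.erase ∅) ((W₁.powerset.erase ∅).erase W₁) bound1 bound2 hW₁notin
        simp only [hHK, hTf] at sb side1 side2 ⊢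
        linarith
      · -- ∅ ∉ F1: side 1 by the fibre injection lemma on F1
        have h0F1 : ∅ ∉ F1 := fun h0 => hV0 (Finset.mem_filter.mp h0).2
        have side1 := hFI₁ F1 hF1sub h0F1
        rw [← hD1F1] at side1
        have bound1 : ∀ ζ ∈ (W₂.powerset.erase ∅).erase W₂, ζ ⊆ W₂ ∧ ζ ≠ ∅ ∧ 𝒱 (ζ ∪ W₁) := by
          intro ζ hζ
          simp only [Finset.mem_erase, Finset.mem_powerset] at hζ
          exact ⟨hζ.2.2, hζ.2.1, hVW₁ ζ⟩
        have sb := hsup_bound ((W₂.powerset.erase ∅).erase W₂) ((W₁.powerset.erase ∅).erase W₁) bound1 bound2 hW₁notin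
        simp only [hHK, hTf] at sb side1 side2 ⊢
        linarith
    · -- (ii) only side 2 carries demand: D1 = ∅; side 2 by the fibre up-set lemma on F2 (its partner for W₁ is the all-red point)
      have hD1empty : D1 = ∅ := by
        rw [Finset.eq_empty_iff_forall_notMem]
        intro η hη
        obtain ⟨hηW, hηV, hηne⟩ := (hmemD1 η).mp hη
        exact hD1ne ⟨η, hηW, hηV, hηne⟩
      have hV0 : ¬ 𝒱 ∅ := fun h0 => hD1ne ⟨∅, Finset.empty_subset _, h0, fun h' => hW₂.ne_empty h'.symm⟩
      have h0F2 : ∅ ∉ F2 := fun h0 => hV0 (Finset.mem_filter.mp h0).2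
      have side2 := hFU₂ F2 hF2sub hF2up hW₁F2
      have eD2 : F2.erase W₁ = D2 := by
        rw [hD2, Finset.erase_eq_of_notMem h0F2]
      rw [eD2] at side2
      have bound2 : ∀ ζ ∈ F2.erase ∅, ζ ⊆ W₁ ∧ ζ ≠ ∅ ∧ 𝒱 (ζ ∪ W₂) := by
        intro ζ hζ
        obtain ⟨hne, hζF⟩ := Finset.mem_erase.mp hζ
        exact ⟨hF2sub ζ hζF, hne, hV Finset.subset_union_left (Finset.mem_filter.mp hζF).2⟩
      -- W₁ ∈ F2.erase ∅ is allowed here: it maps to the all-red point, and side 1 uses nothing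
      have sb : ∑ ζ ∈ F2.erase ∅, HK (ζ ∪ W₂) ≤ Ssup := by
        -- split off ζ = W₁ if present and use hsup_bound for the rest together with the all-red point via Z₁ = {W₂}
        by_cases hW₁in : W₁ ∈ F2.erase ∅
        · have e1 := Finset.sum_erase_add (F2.erase ∅) (fun ζ => HK (ζ ∪ W₂)) hW₁in
          have bound2' : ∀ ζ ∈ (F2.erase ∅).erase W₁, ζ ⊆ W₁ ∧ ζ ≠ ∅ ∧ 𝒱 (ζ ∪ W₂) :=
            fun ζ hζ => bound2 ζ (Finset.mem_of_mem_erase hζ)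
          have bound1 : ∀ ζ ∈ ({W₂} : Finset (Finset ι)), ζ ⊆ W₂ ∧ ζ ≠ ∅ ∧ 𝒱 (ζ ∪ W₁) := by
            intro ζ hζ
            rw [Finset.mem_singleton] at hζ; subst hζ
            refine ⟨le_refl _, fun h' => hW₂.ne_empty h', ?_⟩
            rw [Finset.union_comm]; exact (bound2 W₁ hW₁in).2.2
          have sb' := hsup_bound {W₂} ((F2.erase ∅).erase W₁) bound1 bound2' (Finset.notMem_erase W₁ _)
          rw [Finset.sum_singleton, Finset.union_comm] at sb'
          linarith
        · exact le_trans (le_of_eq (by simp)) ((hsup_bound ∅ (F2.erase ∅) (fun ζ hζ => absurd hζ (Finset.notMem_empty ζ)) bound2 hW₁in))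
      rw [hD1empty, Finset.sum_empty]
      simp only [hHK, hTf] at sb side2 ⊢
      linarith
  · -- (i) side 2 carries no demand: D2 = ∅; side 1 by the fibre up-set lemma on F1
    have hD2empty : D2 = ∅ := by
      rw [Finset.eq_empty_iff_forall_notMem]
      intro η hη
      obtain ⟨hηW, hηV, hη0, hηne⟩ := (hmemD2 η).mp hη
      exact hD2ne ⟨η, hηW, hηV, hη0, hηne⟩
    rw [hD2empty, Finset.sum_empty, add_zero]
    by_cases hVW₂ : 𝒱 W₂
    · have hW₂F1 : W₂ ∈ F1 := Finset.mem_filter.mpr ⟨Finset.mem_powerset.mpr (le_refl W₂), hVW₂⟩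
      have side1 := hFU₁ F1 hF1sub hF1up hW₂F1
      rw [← hD1F1] at side1
      have bound1 : ∀ ζ ∈ F1.erase ∅, ζ ⊆ W₂ ∧ ζ ≠ ∅ ∧ 𝒱 (ζ ∪ W₁) := by
        intro ζ hζ
        obtain ⟨hne, hζF⟩ := Finset.mem_erase.mp hζ
        exact ⟨hF1sub ζ hζF, hne, hV Finset.subset_union_left (Finset.mem_filter.mp hζF).2⟩
      have sb := hsup_bound (F1.erase ∅) ∅ bound1 (fun ζ hζ => absurd hζ (Finset.notMem_empty ζ)) (Finset.notMem_empty W₁)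
      rw [Finset.sum_empty, add_zero] at sb
      simp only [hHK, hTf] at sb side1 ⊢
      linarith
    · have hD1empty : D1 = ∅ := by
        rw [Finset.eq_empty_iff_forall_notMem]
        intro η hη
        obtain ⟨hηW, hηV, _⟩ := (hmemD1 η).mp hη
        exact hVW₂ (hV hηW hηV)
      rw [hD1empty, Finset.sum_empty, add_zero]
      exact hSsup0

end Coefficientwise

end Summit.CriticalPhenomena.PercolationContinuityZ3.Theorems
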